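import Summits.HubbardSuperconductivity.HubbardLadder.ClusterCutBlocks
import HarnessLib

/-!
# Cluster pair-cuts: the integer pair list of cut adv06_it6_s4 (`cut_oct12_adv06oct12it6_s4.json` 323da9f52a9759f2, σ = −1901/10000)

HONEST FRAMING: ladder R1–R4 with certified numbers; no claim on H/H₀.  Cell pub-hubbard, lane r2-eng-1 (g13).  Kernel-side data of the cut
(`DEN = 10⁶`): the integer pair list `adv06it6P` (one orientation `(i, j, DEN·a_o)` per pair of orbit `o`, sites in the order of
`Oct12Representation`) and `pairsOK 12 adv06it6P` (kernel).  The per-piece kernel certificates `ClusterCutOct12Adv06It6FrameNN` are stated for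
`pairOp adv06it6P`; the identity with the cut's symmetric weight table (`= 2 • pairOp adv06it6P`) belongs with the row assembly.  All statements [folklore].
-/

namespace Summit.HubbardSuperconductivity.HubbardLadder.ClusterCut

open Matrix Literature.MathematicalPhysics.QuantumLattice

/-- The integer pair list of cut adv06_it6_s4: one orientation `(i, j, DEN·a_o)` per pair of orbit `o` (`DEN = 10⁶`; 66 pairs). -/
def adv06it6P : NatPairList :=
  [(0, 1, -3055), (0, 2, 9859), (0, 3, 39291), (0, 4, -9140), (0, 5, -3902), (0, 6, -3902),
   (0, 7, 7368), (0, 8, -13406), (0, 9, -2072), (0, 10, -2312), (0, 11, -689), (1, 2, -3902),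
   (1, 3, -9140), (1, 4, 39291), (1, 5, 9859), (1, 6, -2072), (1, 7, -13406), (1, 8, 7368),
   (1, 9, -3902), (1, 10, -689), (1, 11, -2312), (2, 3, 39291), (2, 4, 7368), (2, 5, -2312),
   (2, 6, -3055), (2, 7, -9140), (2, 8, -13406), (2, 9, -689), (2, 10, -3902), (2, 11, -2072),
   (3, 4, 71524), (3, 5, 7368), (3, 6, -9140), (3, 7, 71524), (3, 8, -28551), (3, 9, -13406),
   (3, 10, 7368), (3, 11, -13406), (4, 5, 39291), (4, 6, -13406), (4, 7, -28551), (4, 8, 71524),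
   (4, 9, -9140), (4, 10, -13406), (4, 11, 7368), (5, 6, -689), (5, 7, -13406), (5, 8, -9140),
   (5, 9, -3055), (5, 10, -2072), (5, 11, -3902), (6, 7, 39291), (6, 8, 7368), (6, 9, -2312),
   (6, 10, 9859), (6, 11, -3902), (7, 8, 71524), (7, 9, 7368), (7, 10, 39291), (7, 11, -9140),
   (8, 9, 39291), (8, 10, -9140), (8, 11, 39291), (9, 10, -3902), (9, 11, 9859), (10, 11, -3055)]

/-- Kernel: in every pair of `adv06it6P` the sites are `< 12` and distinct. -/
theorem adv06it6P_ok : pairsOK 12 adv06it6P = true := by decide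

end Summit.HubbardSuperconductivity.HubbardLadder.ClusterCut
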